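import Summits.Ventures.HSemireg.ObstructionLocusBlockIdeal

/-!
# Venture HSemireg — (S5) OBSTRUCTION LOCUS away from secant type, XVI: the BLOCK MODELS `M(S_1, …, S_r)` —
# block structures, the arrangement ideal `I_M = ⋂_i I_{S_i}`, its test elements, and step A on `I_M`

HONEST FRAMING.  Companion of `ObstructionLocusBlockIdeal.lean` (cell `pub-hsemireg`, track «S4-PUSH» (ii), seat
s4-prove-2; vocabulary and honest framing as there): plain commutative algebra in `R = MvPolynomial (Fin n) K`, `K` any
commutative ring, every `n`; nothing here constructs a variety or a sheaf; nothing here says that HC / HC_CM / HC_AV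
holds; no Literature fact is declared or used.  EXT-NOTE §6.0: at a point `q` of `Z_T = ⋃_{t ∈ T} (W + t)` under (GEN)
the blocks are `S_t(q) = {k : q_k = t_k}` (pairwise disjoint) and the germ is `(𝔸ⁿ, M(S_1, …, S_r))` with ideal
`I_M = ⋂_s I_{K_{S_s}}`; this file types that ideal and the TEST ELEMENTS on which files XVII–XIX evaluate normal fields.

* `Blocks ι n` (pairwise disjoint non-empty blocks `S_i ⊂ [n]`; singletons allowed, `I_{{a}} = R`), `rest B i =
  ⋃_{j ≠ i} S_j` and its bookkeeping.
* **`arrIdeal K B = ⋂_i blockIdeal K (S_i)`** (`= I_M`), `mem_arrIdeal_iff'` (monomial ideal: every monomial has at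
  most one zero exponent in each block), `sq_mem_arrIdeal`, **`arrIdeal_eq_prod`** (`⋂_i I_{S_i} = ∏_i I_{S_i}`).
* `gen B i a = x_{S_i ∖ a} · x_{rest i}` (`∈ I_M`: the generator `m^{(i)}_a` of `I_{S_i}` times all the coordinates of
  the other blocks) and its branch partners `genPartner B i a b = x_{S_i ∖ {a,b}} · x_{rest i}`
  (`x_b · genPartner i a b = gen i a`, `x_a · genPartner i a b = gen i b`).
* `X_smul_apply_gen_eq`, **`X_smul_apply_gen_eq_zero`** — STEP A on `I_M`: `x_a · φ(gen i a) = 0` in `R/I_{S_i}` for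
  every `R`-linear `φ : I_M → R/I_{S_i}` and every `a ∈ S_i` (all the `x_a φ(gen i a)` agree, file XV's step A).
* **`exists_eq_mul_of_hom_to_ring`** (`Hom_R(I_M, R) = R·ι`) and `mkQ_comp_hom_to_ring_eq_zero`
  (`Hom_R(I_M, R) → Hom_R(I_M, R/I_M)` is zero) — the block-model form of file X's second half (EXT-NOTE §6.B(b)
  «`Hom_R(I, R) = R` maps to `0` in `Hom(I, A)`», the printed reason for `δ : Hom(I, A) ↪ Ext¹(I, I)`; the `Ext`
  identification itself stays dictionary).
References (dictionary only): EXT-NOTE.md §6.0 (local models), §6.A, §6.B(a); G2-REDUCIBLE-POINT-THEOREM.md §2 L1.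
-/

open scoped BigOperators
open MvPolynomial Finset

namespace Summit.Ventures.HSemireg.ObstructionLocus.BlockModel

variable {K : Type*} [CommRing K] {n : ℕ}

/-! ## Block structures and the arrangement ideal `I_M = ⋂_i I_{S_i}` -/

/-- A BLOCK STRUCTURE on `[n]`: pairwise disjoint non-empty blocks `S_i ⊂ [n]`, `i ∈ ι` (at a point `q` of a (GEN)
arrangement `Z_T`: `S_t(q) = {k : q_k = t_k}` for the translates `t` through `q`; EXT-NOTE §6.0).  Blocks of size
`1` are allowed and harmless (`I_{S} = R`); coordinates in no block are free. -/
structure Blocks (ι : Type*) (n : ℕ) where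
  /-- the blocks -/
  S : ι → Finset (Fin n)
  /-- pairwise disjoint -/
  disjoint : ∀ ⦃i j : ι⦄, i ≠ j → Disjoint (S i) (S j)
  /-- non-empty -/
  nonempty : ∀ i, (S i).Nonempty

variable {ι : Type*}

variable (K) in
/-- The ARRANGEMENT IDEAL of the block model `M(S_1, …, S_r) = ⋃_i K_{S_i} × 𝔸`: `I_M = ⋂_i I_{S_i}`. -/
noncomputable def arrIdeal (B : Blocks ι n) : Ideal (MvPolynomial (Fin n) K) := ⨅ i, blockIdeal K (B.S i)

/-- `I_M ⊂ I_{S_i}`. -/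
theorem arrIdeal_le (B : Blocks ι n) (i : ι) : arrIdeal K B ≤ blockIdeal K (B.S i) := iInf_le _ i

/-- Membership in `I_M`, block by block. -/
theorem mem_arrIdeal_iff {B : Blocks ι n} {f : MvPolynomial (Fin n) K} :
    f ∈ arrIdeal K B ↔ ∀ i, f ∈ blockIdeal K (B.S i) := Ideal.mem_iInf

/-- **Membership in `I_M` is read off the monomials**: every monomial has at most one zero exponent in each block. -/
theorem mem_arrIdeal_iff' {B : Blocks ι n} {f : MvPolynomial (Fin n) K} :
    f ∈ arrIdeal K B ↔ ∀ e ∈ f.support, ∀ i, BlockMem (B.S i) e := by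
  rw [mem_arrIdeal_iff]
  simp only [mem_blockIdeal_iff]
  exact ⟨fun h e he i => h i e he, fun h i e he => h e he i⟩

/-- The square-free monomial `x_T` lies in `I_M` as soon as `T` misses at most one coordinate of each block. -/
theorem sq_mem_arrIdeal {B : Blocks ι n} {T : Finset (Fin n)} (h : ∀ i, ∃ a ∈ B.S i, (B.S i).erase a ⊆ T) :
    (sq T : MvPolynomial (Fin n) K) ∈ arrIdeal K B := by
  rw [mem_arrIdeal_iff]
  intro i
  obtain ⟨a, ha, hsub⟩ := h i
  rw [sq_eq_monomial]
  refine monomial_mem_blockIdeal ⟨a, ha, ?_⟩ 1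
  rw [support_ind]
  exact hsub

variable [Fintype ι]

/-- **`I_M = ∏_i I_{S_i}`** — the intersection is also the product (EXT-NOTE §6.0 «`I = ⋂_s I_{K_{S_s}} = Π_s I_{K_{S_s}}`
(disjoint variables)»): a monomial with at most one zero exponent in each block is a multiple of a product of one
generator `x_{S_i ∖ a_i}` per block. -/
theorem arrIdeal_eq_prod (B : Blocks ι n) : arrIdeal K B = ∏ i, blockIdeal K (B.S i) := by
  classical
  refine le_antisymm ?_ fun f hf => mem_arrIdeal_iff.2 fun i =>
    (Finset.inf_le (Finset.mem_univ i) : (Finset.univ.inf fun i => blockIdeal K (B.S i)) ≤ _)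
      (Ideal.prod_le_inf hf)
  intro f hf
  rw [f.as_sum]
  refine Ideal.sum_mem _ fun e he => ?_
  choose a ha hsub using fun i => (mem_arrIdeal_iff'.1 hf) e he i
  set U : Finset (Fin n) := univ.biUnion fun i => (B.S i).erase (a i) with hU
  have hUe : ind U ≤ e := ind_le_iff.2 (Finset.biUnion_subset.2 fun i _ => hsub i)
  have hsqU : (sq U : MvPolynomial (Fin n) K) = ∏ i, sq ((B.S i).erase (a i)) := by
    rw [hU, sq, Finset.prod_biUnion]
    · rfl
    · intro i _ j _ hij
      exact Finset.disjoint_of_subset_left (erase_subset _ _)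
        (Finset.disjoint_of_subset_right (erase_subset _ _) (B.disjoint hij))
  have hmem : (sq U : MvPolynomial (Fin n) K) ∈ ∏ i, blockIdeal K (B.S i) := by
    rw [hsqU]
    exact Ideal.prod_mem_prod fun i _ => sq_erase_mem (ha i)
  have hfac : monomial e (coeff e f) = monomial (e - ind U) (coeff e f) * (sq U : MvPolynomial (Fin n) K) := by
    rw [sq_eq_monomial, monomial_mul, mul_one, tsub_add_cancel_of_le hUe]
  rw [hfac]
  exact Ideal.mul_mem_left _ _ hmem

/-! ## `Hom_R(I_M, R) = R` -/

/-- A polynomial all of whose monomials are divisible by `x_T` is `x_T` times its monomial quotient. -/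
theorem eq_sq_mul_divMonomial {T : Finset (Fin n)} {f : MvPolynomial (Fin n) K} (h : ∀ e ∈ f.support, ind T ≤ e) :
    f = sq T * f.divMonomial (ind T) := by
  have hmod : f.modMonomial (ind T) = 0 := by
    ext e
    rw [coeff_zero]
    by_cases hle : ind T ≤ e
    · exact coeff_modMonomial_of_le _ hle
    · rw [coeff_modMonomial_of_not_le _ hle]
      by_contra hne
      exact hle (h e (mem_support_iff.2 hne))
  have := f.divMonomial_add_modMonomial (ind T)
  rw [hmod, add_zero, ← sq_eq_monomial] at this
  exact this.symm

/-- All the block coordinates: `allBlocks B = ⋃_i S_i`. -/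
def Blocks.allBlocks (B : Blocks ι n) : Finset (Fin n) := univ.biUnion B.S

/-- `x_{⋃ S_i} ∈ I_M`. -/
theorem sq_allBlocks_mem (B : Blocks ι n) : (sq B.allBlocks : MvPolynomial (Fin n) K) ∈ arrIdeal K B := by
  refine sq_mem_arrIdeal fun i => ?_
  obtain ⟨a, ha⟩ := B.nonempty i
  exact ⟨a, ha, (erase_subset a _).trans (Finset.subset_biUnion_of_mem B.S (mem_univ i))⟩

/-- `x_{(⋃ S_i) ∖ c} ∈ I_M` for every coordinate `c`. -/
theorem sq_allBlocks_erase_mem (B : Blocks ι n) (c : Fin n) :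
    (sq (B.allBlocks.erase c) : MvPolynomial (Fin n) K) ∈ arrIdeal K B := by
  refine sq_mem_arrIdeal fun i => ?_
  by_cases hc : c ∈ B.S i
  · exact ⟨c, hc, Finset.erase_subset_erase c (Finset.subset_biUnion_of_mem B.S (mem_univ i))⟩
  · obtain ⟨a, ha⟩ := B.nonempty i
    refine ⟨a, ha, fun d hd => mem_erase.2 ⟨?_, Finset.subset_biUnion_of_mem B.S (mem_univ i) (mem_erase.1 hd).2⟩⟩
    rintro rfl
    exact hc (mem_erase.1 hd).2

/-- **`Hom_R(I_M, R) = R·ι`**: every `R`-linear map `I_M → R` is multiplication by a polynomial (the block-model form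
of file X's `exists_eq_mul_of_hom_to_ring`; EXT-NOTE §6.B(b) «`Hom_R(I, R) = R`», the printed reason for the
injectivity of `δ : Hom(I, R/I) → Ext¹(I, I)`).  Proof: `φ(x_U)`, `U = ⋃ S_i`, is divisible by every `x_c`, `c ∈ U`
(as `x_U = x_c · x_{U ∖ c}` inside `I_M`), hence by `x_U`; then cancel `x_U` in `x_U φ(u) = u φ(x_U)`. -/
theorem exists_eq_mul_of_hom_to_ring (B : Blocks ι n)
    (φ : ↥(arrIdeal K B) →ₗ[MvPolynomial (Fin n) K] MvPolynomial (Fin n) K) :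
    ∃ r : MvPolynomial (Fin n) K, ∀ u : ↥(arrIdeal K B), φ u = r * u.1 := by
  classical
  set v₀ : ↥(arrIdeal K B) := ⟨sq B.allBlocks, sq_allBlocks_mem B⟩ with hv₀
  have hdiv : ∀ e ∈ (φ v₀).support, ind B.allBlocks ≤ e := by
    intro e he
    refine ind_le_iff.2 fun c hc => ?_
    have hfac : v₀ = (X c : MvPolynomial (Fin n) K) • (⟨sq (B.allBlocks.erase c), sq_allBlocks_erase_mem B c⟩ :
        ↥(arrIdeal K B)) := by
      apply Subtype.ext
      change sq B.allBlocks = X c * sq (B.allBlocks.erase c)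
      rw [X_mul_sq_erase hc]
    rw [hfac, map_smul, smul_eq_mul, support_X_mul, Finset.mem_map] at he
    obtain ⟨e', -, rfl⟩ := he
    simp only [addLeftEmbedding_apply, Finsupp.mem_support_iff, Finsupp.coe_add, Pi.add_apply,
      Finsupp.single_eq_same]
    omega
  set r : MvPolynomial (Fin n) K := (φ v₀).divMonomial (ind B.allBlocks) with hr
  have hF : φ v₀ = sq B.allBlocks * r := by rw [hr]; exact eq_sq_mul_divMonomial hdiv
  refine ⟨r, fun u => ?_⟩
  have key : (sq B.allBlocks : MvPolynomial (Fin n) K) * φ u = sq B.allBlocks * (r * u.1) := by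
    have h1 : (sq B.allBlocks : MvPolynomial (Fin n) K) • u = u.1 • v₀ := by
      apply Subtype.ext
      change sq B.allBlocks * u.1 = u.1 * sq B.allBlocks
      rw [mul_comm]
    calc (sq B.allBlocks : MvPolynomial (Fin n) K) * φ u = φ ((sq B.allBlocks : MvPolynomial (Fin n) K) • u) := by
          rw [map_smul, smul_eq_mul]
      _ = u.1 * φ v₀ := by rw [h1, map_smul, smul_eq_mul]
      _ = sq B.allBlocks * (r * u.1) := by rw [hF]; ring
  have := eq_zero_of_sq_mul_eq_zero (T := B.allBlocks) (p := φ u - r * u.1) (by rw [mul_sub, key, sub_self])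
  exact sub_eq_zero.1 this

/-- Hence **`Hom_R(I_M, R) → Hom_R(I_M, R/I_M)` is the zero map** (block-model form of file X's
`mkQ_comp_hom_to_ring_eq_zero`). -/
theorem mkQ_comp_hom_to_ring_eq_zero (B : Blocks ι n)
    (φ : ↥(arrIdeal K B) →ₗ[MvPolynomial (Fin n) K] MvPolynomial (Fin n) K) :
    (Submodule.mkQ (arrIdeal K B)).comp φ = 0 := by
  obtain ⟨r, hr⟩ := exists_eq_mul_of_hom_to_ring B φ
  apply LinearMap.ext
  intro u
  rw [LinearMap.comp_apply, Submodule.mkQ_apply, LinearMap.zero_apply, hr u, Submodule.Quotient.mk_eq_zero]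
  exact Ideal.mul_mem_left _ r u.2


variable [DecidableEq ι]

/-- The coordinates of the OTHER blocks: `rest i = ⋃_{j ≠ i} S_j`. -/
def Blocks.rest (B : Blocks ι n) (i : ι) : Finset (Fin n) := (univ.erase i).biUnion B.S

/-- `S_j ⊂ rest i` for `j ≠ i`. -/
theorem Blocks.subset_rest (B : Blocks ι n) {i j : ι} (h : j ≠ i) : B.S j ⊆ B.rest i :=
  Finset.subset_biUnion_of_mem B.S (mem_erase.2 ⟨h, mem_univ j⟩)

/-- `rest i ∩ S_i = ∅`. -/
theorem Blocks.disjoint_rest (B : Blocks ι n) (i : ι) : Disjoint (B.rest i) (B.S i) := by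
  rw [Blocks.rest, Finset.disjoint_biUnion_left]
  intro j hj
  exact B.disjoint (mem_erase.1 hj).1

/-- A coordinate of block `i` is not in `rest i`. -/
theorem Blocks.notMem_rest (B : Blocks ι n) {i : ι} {a : Fin n} (ha : a ∈ B.S i) : a ∉ B.rest i :=
  fun h => Finset.disjoint_left.1 (B.disjoint_rest i) h ha

/-- A coordinate of block `i` lies in `rest j` for `j ≠ i`. -/
theorem Blocks.mem_rest (B : Blocks ι n) {i j : ι} (h : i ≠ j) {a : Fin n} (ha : a ∈ B.S i) : a ∈ B.rest j :=
  B.subset_rest h ha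

/-- The TEST ELEMENT of block `i` at `a ∈ S_i`: `gen i a = x_{S_i ∖ a} · x_{rest i} ∈ I_M` (the generator `m^{(i)}_a`
of `I_{S_i}` times all the coordinates of the other blocks). -/
noncomputable def gen (B : Blocks ι n) (i : ι) (a : Fin n) : MvPolynomial (Fin n) K :=
  sq ((B.S i).erase a ∪ B.rest i)

/-- Its partner on the branch `V(x_a, x_b)`: `genPartner i a b = x_{S_i ∖ {a,b}} · x_{rest i}` (so that
`x_b · genPartner i a b = gen i a`). -/
noncomputable def genPartner (B : Blocks ι n) (i : ι) (a b : Fin n) : MvPolynomial (Fin n) K :=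
  sq (((B.S i).erase a).erase b ∪ B.rest i)

/-- `gen i a ∈ I_M`. -/
theorem gen_mem (B : Blocks ι n) {i : ι} {a : Fin n} (ha : a ∈ B.S i) : (gen B i a : MvPolynomial (Fin n) K) ∈ arrIdeal K B := by
  refine sq_mem_arrIdeal fun j => ?_
  by_cases hj : j = i
  · subst hj
    exact ⟨a, ha, subset_union_left⟩
  · obtain ⟨c, hc⟩ := B.nonempty j
    exact ⟨c, hc, ((erase_subset c _).trans (B.subset_rest hj)).trans subset_union_right⟩

/-- `x_b · genPartner i a b = gen i a` for `b ∈ S_i ∖ a`. -/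
theorem X_mul_genPartner (B : Blocks ι n) {i : ι} {a b : Fin n} (hb : b ∈ (B.S i).erase a) :
    X b * genPartner B i a b = (gen B i a : MvPolynomial (Fin n) K) := by
  have hb' : b ∉ B.rest i := B.notMem_rest (mem_erase.1 hb).2
  rw [genPartner, gen, sq_union, sq_union, ← mul_assoc, X_mul_sq_erase hb]
  · exact Finset.disjoint_of_subset_left (erase_subset a _) (B.disjoint_rest i).symm
  · exact Finset.disjoint_of_subset_left ((erase_subset b _).trans (erase_subset a _)) (B.disjoint_rest i).symm

/-- `x_a · genPartner i a b = gen i b` for `b ∈ S_i ∖ a`. -/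
theorem X_mul_genPartner' (B : Blocks ι n) {i : ι} {a b : Fin n} (ha : a ∈ B.S i) (hb : b ∈ (B.S i).erase a) :
    X a * genPartner B i a b = (gen B i b : MvPolynomial (Fin n) K) := by
  rw [genPartner, Finset.erase_right_comm]
  exact X_mul_genPartner B (mem_erase.2 ⟨(mem_erase.1 hb).1.symm, ha⟩)

/-- `x_a · gen i a = x_{S_i ∪ rest i}`, independent of `a ∈ S_i`. -/
theorem X_mul_gen (B : Blocks ι n) {i : ι} {a : Fin n} (ha : a ∈ B.S i) :
    X a * gen B i a = (sq (B.S i ∪ B.rest i) : MvPolynomial (Fin n) K) := by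
  rw [gen, sq_union (Finset.disjoint_of_subset_left (erase_subset a _) (B.disjoint_rest i).symm),
    ← mul_assoc, X_mul_sq_erase ha, sq_union (B.disjoint_rest i).symm]

/-- For ANY `R`-linear `φ : I_M → R/I_{S_i}`: `x_a φ(gen i a) = x_b φ(gen i b)` for `a, b ∈ S_i`. -/
theorem X_smul_apply_gen_eq (B : Blocks ι n) {i : ι}
    (φ : ↥(arrIdeal K B) →ₗ[MvPolynomial (Fin n) K] MvPolynomial (Fin n) K ⧸ blockIdeal K (B.S i))
    (a b : ↥(B.S i)) :
    (X a.1 : MvPolynomial (Fin n) K) • φ ⟨gen B i a.1, gen_mem B a.2⟩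
      = (X b.1 : MvPolynomial (Fin n) K) • φ ⟨gen B i b.1, gen_mem B b.2⟩ := by
  rw [← map_smul, ← map_smul]
  congr 1
  apply Subtype.ext
  change X a.1 * gen B i a.1 = X b.1 * gen B i b.1
  rw [X_mul_gen B a.2, X_mul_gen B b.2]

/-- Hence (STEP A) `x_a · φ(gen i a) = 0` in `R/I_{S_i}` for every such `φ` and every `a ∈ S_i`. -/
theorem X_smul_apply_gen_eq_zero (B : Blocks ι n) {i : ι}
    (φ : ↥(arrIdeal K B) →ₗ[MvPolynomial (Fin n) K] MvPolynomial (Fin n) K ⧸ blockIdeal K (B.S i))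
    (a : ↥(B.S i)) :
    (X a.1 : MvPolynomial (Fin n) K) • φ ⟨gen B i a.1, gen_mem B a.2⟩ = 0 :=
  X_smul_eq_zero_of_forall_X_smul_eq (fun a : ↥(B.S i) => φ ⟨gen B i a.1, gen_mem B a.2⟩)
    (X_smul_apply_gen_eq B φ) a

end Summit.Ventures.HSemireg.ObstructionLocus.BlockModel
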